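import Summits.NavierStokesRegularity.NavierStokesRegularity.Theorems.HeredityAtOne.Negative.ReadoutFloorsAtOneFalseOfCappedStageAtOne
import Summits.NavierStokesRegularity.NavierStokesRegularity.Theorems.HeredityAtOne.Negative.HeredityAtOneFalseOfNoSwirlCappedStageAtOne

/-! # The cap lever's witness window: `c₁ Y_k ≤ Φ(u(τ_k)) < c₁ Y_{k+1}`

A NECESSARY CONDITION on the witness class `CappedStageAt k` of the T2 r3 ∀-form cap lever
(`HeredityAtOneFalseOfCappedStageAtOne.lean`, p448312), formalising census (ii) there («the cap must be
nearly TIGHT on the slice»): a registered stage at level `k ≥ 1` reads the floor `c₁ Y_k` somewhere in the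
ball AT `τ_k` (`Stage.floor`), and — local continuation across `τ_k` being a tree THEOREM
(`palasekTowerBreakdown_localContinuationAt_holds`) — the window cap already binds at the instant `τ_k`
(`speed_le_cap_of_windowSpeedCap`, p455726), so

* `floor_le_cap_of_stage` — every registered level-`k` stage (`k ≥ 1`) of a pinned rigid quiet wide design
  whose `τ_k`-slice lies in a capped window class `(𝒜, Φ)` has `c₁ Y_k ≤ Φ(u(τ_k))`;
* `cappedStageAt_window` — hence every witness of `CappedStageAt k` sits in the window
  `c₁ Y_k ≤ Φ(u(τ_k)) < c₁ Y_{k+1}`: the printed cap functional of the slice must lie within the factor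
  `Y_{k+1} / Y_k` (`= N_k^{(b-1)(β-1)}`, `≈ 2.21` at `k = 1` on `TowerRates.wide`) of the slice's own floor
  reading — for the Gallay–Šverák cap `C (‖ω_θ‖₁ ‖r²ω_θ‖₁)^{1/4} ‖ω_θ/r‖_∞^{1/2}` this is the
  near-top-hat-core regime `κ > 0.871` of the cell's KJ-13 computation (thin rings are excluded: their
  cap / sup-speed ratio is `≥ 1.924 / κ`);
* `not_cappedStage_of_cap_lt_floor` — contrapositively, a slice whose cap value is BELOW its level's floor,
  `Φ(u(τ_k)) < c₁ Y_k`, is never the `τ_k`-slice of a registered stage: that part of the capped class is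
  EMPTY by theorem (the rest, `Φ ≥ c₁ Y_k`, is the open census (i)).

§2 discharges the same window to the typed Gallay–Šverák facts (the bridge of
`HeredityAtOneFalseOfNoSwirlCappedStageAtOne.lean`, p451698, re-run on an arbitrary CONTINUATION instead of
an extension stage): `continuation_hasBoundedSobolevNormsOn`, `continuation_isHkClassicalSolutionOn_quiet`
(the quiet era of any finite-energy classical continuation of a registered stage is in the tree's Tao
class), `floor_le_noSwirlCap_of_stage` — **every registered stage at level `k ≥ 1` whose `τ_k`-slice is
single-signed swirl-free with height `M` has `c₁ Y_k ≤ C √(√((∫η)(∫r²η)) M)`** for every cap constant `C`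
(`IsNoSwirlCapConstant`), i.e. modulo `VelocitySupBound ∧ ImpulseConservation`
(`registered_noSwirl_slice_window`): a swirl-free single-signed slice with GS functional `< Y_k / C` is
NEVER registered at level `k`; and every witness of `NoSwirlCappedStageAtOne` sits in the window
`c₁ Y₁ ≤ C √(…) < c₁ Y₂` (`noSwirlCappedStageAtOne_window`).

Negative lane; nothing asserts a route item; `CappedStageAt k` / `NoSwirlCappedStageAtOne` stay hypotheses.
-/

open Set MeasureTheory
open scoped ENNReal
open Literature.Analysis.FluidPDE
open Summit.NavierStokesRegularity.FluidComputer
open Summit.NavierStokesRegularity.FluidComputer.PalasekTowerClayBridge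
open Summit.NavierStokesRegularity.HeredityAtOneSpeedCap
open Summit.NavierStokesRegularity.HeredityAtOneNoSwirlCap
open Summit.NavierStokesRegularity.HeredityAtOneStubExposure

noncomputable section

namespace Summit.NavierStokesRegularity.HeredityAtOneCapWindow

/-! ## §1 The abstract window (any printed window cap) -/

section Abstract

variable {𝒜 : Set (EuclideanSpace ℝ (Fin 3) → EuclideanSpace ℝ (Fin 3))}
  {Φ : (EuclideanSpace ℝ (Fin 3) → EuclideanSpace ℝ (Fin 3)) → ℝ}
  {S : Schedule TowerRates.wide} {k : ℕ}

/-- **The cap binds at the instant `τ_k`: floor ≤ cap.** A registered stage at level `k ≥ 1` of a pinned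
rigid quiet wide design whose `τ_k`-slice lies in the capped class has `c₁ Y_k ≤ Φ(u(τ_k))`: continue the
stage across `τ_k` (tree theorem `palasekTowerBreakdown_localContinuationAt_holds`), apply the window cap on
`[τ_k, T']` at `t = τ_k`, and compare with the stage's floor reading at `τ_k`. [cite: GallaySverak2016, Prop. 2.6] -/
theorem floor_le_cap_of_stage (hcap : WindowSpeedCap 𝒜 Φ) (hP : S.Pins 8 (6 / 5)) (hR : S.Rigid)
    (hQ : S.Quiet) (hk : 1 ≤ k) (s : Stage 1 TowerRates.wide S (Margins.routeG TowerRates.wide) k)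
    (hA : s.u (S.τ k) ∈ 𝒜) : S.c₁ * TowerRates.wide.Y k ≤ Φ (s.u (S.τ k)) := by
  obtain ⟨T', hT', u, p, hu, hus, hE⟩ :=
    Summit.NavierStokesRegularity.NavierStokesRegularity.Theorems.palasekTowerBreakdown_localContinuationAt_holds
      k S hP hR hQ s
  obtain ⟨x, -, hfl⟩ := s.floor k le_rfl
  have hle := speed_le_cap_of_windowSpeedCap hcap hQ hk s hA hT' hu hus hE (S.τ k) ⟨le_rfl, hT'.le⟩ x
  rw [(hus (S.τ k) ⟨(S.τ_pos k).le, le_rfl⟩).1] at hle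
  exact hfl.trans hle

/-- **A slice capped BELOW its own level's floor is never registered**: if `Φ(v) < c₁ Y_k` then no
registered level-`k` stage (`k ≥ 1`) of a pinned rigid quiet wide design has `τ_k`-slice `v ∈ 𝒜` — this
part of the capped class is EMPTY by theorem. [cite: GallaySverak2016, Prop. 2.6] -/
theorem not_cappedStage_of_cap_lt_floor (hcap : WindowSpeedCap 𝒜 Φ) (hP : S.Pins 8 (6 / 5))
    (hR : S.Rigid) (hQ : S.Quiet) (hk : 1 ≤ k)
    (s : Stage 1 TowerRates.wide S (Margins.routeG TowerRates.wide) k)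
    (hΦ : Φ (s.u (S.τ k)) < S.c₁ * TowerRates.wide.Y k) : s.u (S.τ k) ∉ 𝒜 := fun hA =>
  absurd (floor_le_cap_of_stage hcap hP hR hQ hk s hA) (not_le.2 hΦ)

/-- **The witness window of `H_cap(k)`**: every witness of `CappedStageAt k` (`k ≥ 1`) carries a registered
stage whose slice's cap value lies in `[c₁ Y_k, c₁ Y_{k+1})` — within the factor `Y_{k+1}/Y_k` of its
floor reading (`≈ 2.21` at `k = 1` on the wide register): the cap must be nearly tight on the slice.
[cite: GallaySverak2016, Prop. 2.6] -/
theorem cappedStageAt_window (hk : 1 ≤ k) (hW : CappedStageAt k) :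
    ∃ (𝒜 : Set (EuclideanSpace ℝ (Fin 3) → EuclideanSpace ℝ (Fin 3)))
      (Φ : (EuclideanSpace ℝ (Fin 3) → EuclideanSpace ℝ (Fin 3)) → ℝ), WindowSpeedCap 𝒜 Φ ∧
      ∃ (S : Schedule TowerRates.wide)
        (s : Stage 1 TowerRates.wide S (Margins.routeG TowerRates.wide) k),
        s.u (S.τ k) ∈ 𝒜 ∧ S.c₁ * TowerRates.wide.Y k ≤ Φ (s.u (S.τ k)) ∧
          Φ (s.u (S.τ k)) < S.c₁ * TowerRates.wide.Y (k + 1) := by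
  obtain ⟨𝒜, Φ, hcap, S, s, hP, hR, hQ, hA, hΦ⟩ := hW
  exact ⟨𝒜, Φ, hcap, S, s, hA, floor_le_cap_of_stage hcap hP hR hQ hk s hA, hΦ⟩

/-- **At the first rung**: a witness of `CappedStageAtOne` has `c₁ Y₁ ≤ Φ(u(τ₁)) < c₁ Y₂` (with `c₁ = 1`
on a rigid design: `Y₁ ≈ 2778 ≤ Φ < Y₂ ≈ 6140`). [cite: GallaySverak2016, Prop. 2.6] -/
theorem cappedStageAtOne_window (hW : CappedStageAtOne) :
    ∃ (𝒜 : Set (EuclideanSpace ℝ (Fin 3) → EuclideanSpace ℝ (Fin 3)))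
      (Φ : (EuclideanSpace ℝ (Fin 3) → EuclideanSpace ℝ (Fin 3)) → ℝ), WindowSpeedCap 𝒜 Φ ∧
      ∃ (S : Schedule TowerRates.wide)
        (s : Stage 1 TowerRates.wide S (Margins.routeG TowerRates.wide) 1),
        s.u (S.τ 1) ∈ 𝒜 ∧ S.c₁ * TowerRates.wide.Y 1 ≤ Φ (s.u (S.τ 1)) ∧
          Φ (s.u (S.τ 1)) < S.c₁ * TowerRates.wide.Y 2 :=
  cappedStageAt_window le_rfl hW

end Abstract

/-! ## §2 The window discharged to the Gallay–Šverák facts -/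

section NoSwirl

variable {R : TowerRates} {S : Schedule R} {m : Margins R}

/-- A finite-energy classical CONTINUATION `(u, p)` of a registered stage (design force, agreeing with the
stage on `[0, τ_j]`) on `[0, T']`, `T' > τ_j`, has all `L²`-Sobolev norms bounded on `[0, T']` (smooth
compactly supported datum `S.u₀ = u(0)`, Clay force). [cite: Tao2011, Cor. 4.3 + Thm. 5.4 (iv)] -/
theorem continuation_hasBoundedSobolevNormsOn {j : ℕ} (s : Stage 1 R S m j) {T' : ℝ}
    (hT' : S.τ j < T') {u : ℝ → EuclideanSpace ℝ (Fin 3) → EuclideanSpace ℝ (Fin 3)}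
    {p : ℝ → EuclideanSpace ℝ (Fin 3) → ℝ} (hu : IsClassicalNSSolutionOn (Icc 0 T') 1 S.f u p)
    (hus : ∀ t ∈ Icc 0 (S.τ j), u t = s.u t ∧ p t = s.p t)
    (hE : ∃ C : ℝ≥0∞, C < ⊤ ∧ ∀ t ∈ Icc 0 T', ∫⁻ x, ‖u t x‖ₑ ^ 2 ≤ C) :
    HasBoundedSobolevNormsOn (Icc 0 T') u := by
  have hE' : ∃ C : NNReal, ∀ t ∈ Icc 0 T', ∫⁻ x, ‖u t x‖ₑ ^ 2 ≤ C := by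
    obtain ⟨C, hC, hb⟩ := hE
    exact ⟨C.toNNReal, fun t ht => (hb t ht).trans (ENNReal.coe_toNNReal hC.ne).ge⟩
  have h₀ : HasRapidSpatialDecay (u 0) := by
    rw [(hus 0 ⟨le_rfl, (S.τ_pos j).le⟩).1, s.initial]
    exact S.datum_decay
  exact hu.hasBoundedSobolevNormsOn_of_clayForce one_pos ((S.τ_pos j).trans hT') hE' h₀ S.force_smooth
    S.force_decay

/-- **The quiet era of any continuation is in the Tao class**: for a quiet design, `k ≥ 1`, a registered
level-`k` stage and a finite-energy classical continuation `(u, p)` on `[0, T']`, `T' > τ_k`, the translate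
`t ↦ u(t + τ_k)` is an UNFORCED classical solution on `[0, T' - τ_k]` with all `L²` Sobolev norms bounded.
[cite: Tao2011, Cor. 4.3 + Thm. 5.4 (iv)] -/
theorem continuation_isHkClassicalSolutionOn_quiet (hQ : S.Quiet) {k : ℕ} (hk : 1 ≤ k)
    (s : Stage 1 R S m k) {T' : ℝ} (hT' : S.τ k < T')
    {u : ℝ → EuclideanSpace ℝ (Fin 3) → EuclideanSpace ℝ (Fin 3)}
    {p : ℝ → EuclideanSpace ℝ (Fin 3) → ℝ} (hu : IsClassicalNSSolutionOn (Icc 0 T') 1 S.f u p)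
    (hus : ∀ t ∈ Icc 0 (S.τ k), u t = s.u t ∧ p t = s.p t)
    (hE : ∃ C : ℝ≥0∞, C < ⊤ ∧ ∀ t ∈ Icc 0 T', ∫⁻ x, ‖u t x‖ₑ ^ 2 ≤ C) :
    IsHkClassicalSolutionOn (Icc 0 (T' - S.τ k)) (fun t => u (t + S.τ k))
      (fun t => p (t + S.τ k)) := by
  have htr := hu.translate_Icc_zero_anyForce (S.τ_pos k).le hT'
  refine ⟨htr.congr_force fun t ht x => ?_, fun n => ?_⟩
  · have h0 : S.f (t + S.τ k) = 0 := hQ (t + S.τ k) (by linarith [ht.1, S.τ_mono hk])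
    simp [h0]
  · obtain ⟨C, hC⟩ := continuation_hasBoundedSobolevNormsOn s hT' hu hus hE n
    exact ⟨max 1 C, fun t ht =>
      eLpNorm_two_le_max_of_lintegral_sq_le (hC (t + S.τ k) ⟨by linarith [ht.1, S.τ_pos k],
        by linarith [ht.2]⟩)⟩

end NoSwirl

/-- **Floor ≤ GS cap on every single-signed swirl-free registered slice.** If `C` validates the cap
(`IsNoSwirlCapConstant C`), then every registered stage at level `k ≥ 1` of a pinned rigid quiet wide
design whose `τ_k`-slice is single-signed swirl-free with height `M` satisfies
`c₁ Y_k ≤ C √(√((∫η)(∫r²η)) M)` (functional of the slice): continue across `τ_k` (tree theorem), put the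
quiet era in the Tao class, apply the cap at the instant `τ_k`, compare with the floor reading.
[cite: GallaySverak2016, Prop. 2.6 (2.14)] -/
theorem floor_le_noSwirlCap_of_stage {C : ℝ} (hC : IsNoSwirlCapConstant C) {S : Schedule TowerRates.wide}
    (hP : S.Pins 8 (6 / 5)) (hR : S.Rigid) (hQ : S.Quiet) {k : ℕ} (hk : 1 ≤ k)
    (s : Stage 1 TowerRates.wide S (Margins.routeG TowerRates.wide) k) {M : ℝ}
    (hsl : SignedNoSwirlSlice (s.u (S.τ k)) M) :
    S.c₁ * TowerRates.wide.Y k ≤ C * Real.sqrt (Real.sqrt ((∫ y, angVortQuot (s.u (S.τ k)) y) *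
      ∫ y, cylRadius y ^ 2 * angVortQuot (s.u (S.τ k)) y) * M) := by
  obtain ⟨T', hT', u, p, hu, hus, hE⟩ :=
    Summit.NavierStokesRegularity.NavierStokesRegularity.Theorems.palasekTowerBreakdown_localContinuationAt_holds
      k S hP hR hQ s
  have hk0 : u (S.τ k) = s.u (S.τ k) := (hus (S.τ k) ⟨(S.τ_pos k).le, le_rfl⟩).1
  obtain ⟨q, hTao⟩ :=
    (continuation_isHkClassicalSolutionOn_quiet hQ hk s hT' hu hus hE).exists_isTaoSolutionOn
      (sub_pos.2 hT')
  simp only [zero_add] at hTao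
  rw [hk0] at hTao
  obtain ⟨x, -, hfl⟩ := s.floor k le_rfl
  have hb := hC.2 (sub_pos.2 hT') hTao hsl.axisym hsl.noSwirl hsl.nonneg hsl.le hsl.integrable
    hsl.integrable_sq 0 ⟨le_rfl, (sub_pos.2 hT').le⟩ x
  simp only [zero_add] at hb
  rw [hk0] at hb
  exact hfl.trans hb

/-- **A single-signed swirl-free slice whose GS functional is below its level's floor is never
registered** (`k ≥ 1`). [cite: GallaySverak2016, Prop. 2.6 (2.14)] -/
theorem not_signedNoSwirlSlice_of_noSwirlCap_lt_floor {C : ℝ} (hC : IsNoSwirlCapConstant C)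
    {S : Schedule TowerRates.wide} (hP : S.Pins 8 (6 / 5)) (hR : S.Rigid) (hQ : S.Quiet) {k : ℕ}
    (hk : 1 ≤ k) (s : Stage 1 TowerRates.wide S (Margins.routeG TowerRates.wide) k) {M : ℝ}
    (hlt : C * Real.sqrt (Real.sqrt ((∫ y, angVortQuot (s.u (S.τ k)) y) *
      ∫ y, cylRadius y ^ 2 * angVortQuot (s.u (S.τ k)) y) * M) < S.c₁ * TowerRates.wide.Y k) :
    ¬ SignedNoSwirlSlice (s.u (S.τ k)) M := fun hsl =>
  absurd (floor_le_noSwirlCap_of_stage hC hP hR hQ hk s hsl) (not_le.2 hlt)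

/-- **Modulo the two printed GS15 facts**: there is a constant `C ≥ 0` such that EVERY registered stage at
level `k ≥ 1` of a pinned rigid quiet wide design with single-signed swirl-free `τ_k`-slice of height `M`
has `c₁ Y_k ≤ C √(√((∫η)(∫r²η)) M)` — the registered swirl-free class lives in the GS-tight window.
[cite: GallaySverak2016, Prop. 2.6 (2.14), Lemma 6.4] -/
theorem registered_noSwirl_slice_window (hBS : GallaySverak2015.VelocitySupBound)
    (hI : GallaySverak2015.ImpulseConservation) :
    ∃ C : ℝ, 0 ≤ C ∧ ∀ (S : Schedule TowerRates.wide), S.Pins 8 (6 / 5) → S.Rigid → S.Quiet →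
      ∀ (k : ℕ), 1 ≤ k → ∀ (s : Stage 1 TowerRates.wide S (Margins.routeG TowerRates.wide) k) (M : ℝ),
        SignedNoSwirlSlice (s.u (S.τ k)) M →
          S.c₁ * TowerRates.wide.Y k ≤ C * Real.sqrt (Real.sqrt ((∫ y, angVortQuot (s.u (S.τ k)) y) *
            ∫ y, cylRadius y ^ 2 * angVortQuot (s.u (S.τ k)) y) * M) := by
  obtain ⟨C, hC⟩ := exists_isNoSwirlCapConstant hBS hI
  exact ⟨C, hC.1, fun S hP hR hQ k hk s M hsl => floor_le_noSwirlCap_of_stage hC hP hR hQ hk s hsl⟩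

/-- **The witness window of `H_GS(1)`**: every witness of `NoSwirlCappedStageAtOne` has
`c₁ Y₁ ≤ C √(√((∫η)(∫r²η)) M) < c₁ Y₂` — the GS bound must be tight within the factor `Y₂/Y₁ ≈ 2.21` on
the registered slice (the cell's KJ-13: near-top-hat cores `κ > 0.871` only). [cite: GallaySverak2016, Prop. 2.6 (2.14)] -/
theorem noSwirlCappedStageAtOne_window (hW : NoSwirlCappedStageAtOne) :
    ∃ C : ℝ, IsNoSwirlCapConstant C ∧
      ∃ (S : Schedule TowerRates.wide)
        (s : Stage 1 TowerRates.wide S (Margins.routeG TowerRates.wide) 1) (M : ℝ),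
        SignedNoSwirlSlice (s.u (S.τ 1)) M ∧
          S.c₁ * TowerRates.wide.Y 1 ≤ C * Real.sqrt (Real.sqrt ((∫ y, angVortQuot (s.u (S.τ 1)) y) *
            ∫ y, cylRadius y ^ 2 * angVortQuot (s.u (S.τ 1)) y) * M) ∧
          C * Real.sqrt (Real.sqrt ((∫ y, angVortQuot (s.u (S.τ 1)) y) *
            ∫ y, cylRadius y ^ 2 * angVortQuot (s.u (S.τ 1)) y) * M) < S.c₁ * TowerRates.wide.Y 2 := by
  obtain ⟨C, hC, S, s, M, hP, hR, hQ, hsl, hlt⟩ := hW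
  exact ⟨C, hC, S, s, M, hsl, floor_le_noSwirlCap_of_stage hC hP hR hQ le_rfl s hsl, hlt⟩

end Summit.NavierStokesRegularity.HeredityAtOneCapWindow

end
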